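import Summits.AtomisticToContinuum.BoseEinsteinCondensation.Theorems.BECInsertionCorrectorCorrectorClosureFlatDomination
import Literature.MathematicalPhysics.QuantumManyBody.PeriodicBoseGasImpurityTranslation
import HarnessLib

/-!
# Flat Jensen bound for the insertion partition function (line `residue-area-law`, stub 3)

Crux `BECInsertionCorrector.CorrectorClosure` (item stmt-AtomisticToContinuum-12058), line
`residue-area-law`, stub `stub_flatJensen`. With `Θ₀` the `N`-body torus Feynman–Kac ground
state (`IsPeriodicGroundStateFK v L Θ₀`), `ψ₀ X = Θ₀ (vecTail X)` (particle `0` added flat) and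
`Z t = ∫⁻_{cellN (N+1) L} ψ₀ · e^{-tH_{N+1}} ψ₀` (through `periodicFKSemigroup v L t`), we prove
`Z t ≥ L³ e^{-t(E₀(N) + κN/L³)}`, `κ = ∫_{ℝ³} v(|z|) dz` (finite for bounded finite-range `v`).
Path-space proof, multiplicative in `ℝ≥0∞`, no spectral theory: by `periodicInteraction_succ`
the `(N+1)`-body action is the coupling action `a = ∫₀ᵗ ∑ⱼ v^per(B⁰_s - Bʲ⁺¹_s) ds` of particle
`0` plus the bath action of the tails, so the weight is `e^{-a} · (bath weight)` (`expNeg_add`);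
the tangent line `e^{-m}(1+m) ≤ e^{-a} + e^{-m} a` of the convex `e^{-x}`, integrated, gives
`e^{-m}(1+m) Z_dec ≤ Z t + e^{-m} S`; `Z_dec = e^{-tE₀} L³` (the first world-line marginalises
out of `wienerPaths (N+1)`, `flatDom_lintegral_tail`, and `e^{-tH_N}Θ₀ = e^{-tE₀}Θ₀`);
`S = tNκ e^{-tE₀}` (Tonelli with the start `x₀ ∈ cell L` of particle `0` innermost and the
stationarity `∫_cell v^per(x₀ - c) dx₀ = κ` for every shift `c`,
`lintegral_cell_periodizedPotential_sub`); finally `m = tNκ/L³` makes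
`e^{-m} S = e^{-m} m e^{-tE₀} L³`, a finite term that cancels.
-/

noncomputable section

open MeasureTheory Filter Matrix
open scoped ENNReal NNReal BigOperators

namespace Summit.AtomisticToContinuum.BoseEinsteinCondensation.Theorems.CorrectorClosure.ResidueAreaLaw

open Literature.MathematicalPhysics.QuantumManyBody.BoseGas

variable {N : ℕ}

/-- For a bounded finite-range `v`, `∫_{ℝ³} v(|z|) dz < ∞` (`v ≤ C` on the ball of radius
`R₀`, zero outside). [folklore] -/
theorem flatJensen_lintegral_potential_ne_top {v : ℝ → ℝ≥0∞} (hv : IsRepulsiveFiniteRange v)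
    (hbdd : ∃ C : ℝ≥0, ∀ r, v r ≤ C) : ∫⁻ z : Space, v ‖z‖ ≠ ⊤ := by
  obtain ⟨C, hC⟩ := hbdd
  obtain ⟨R₀, hR⟩ := hv.2
  have hle : ∀ z : Space,
      v ‖z‖ ≤ (Metric.closedBall (0 : Space) R₀).indicator (fun _ => (C : ℝ≥0∞)) z := by
    intro z
    by_cases hz : z ∈ Metric.closedBall (0 : Space) R₀
    · rw [Set.indicator_of_mem hz]; exact hC _
    · rw [Set.indicator_of_notMem hz,
        hR _ (by rwa [Metric.mem_closedBall, dist_zero_right, not_le] at hz)]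
  refine ne_top_of_le_ne_top ?_ (lintegral_mono hle)
  rw [lintegral_indicator_const measurableSet_closedBall]
  exact ENNReal.mul_ne_top ENNReal.coe_ne_top measure_closedBall_lt_top.ne

/-- **Tangent line of the convex `x ↦ e^{-x}` at `x = m`, on `[0, ∞]`**:
`e^{-m}(1 + m) ≤ e^{-a} + e^{-m} a` (for `a = ∞` the right side is `∞`). [folklore] -/
theorem flatJensen_tangent (a : ℝ≥0∞) (m : ℝ) :
    ENNReal.ofReal (Real.exp (-m) * (1 + m)) ≤ expNeg a + ENNReal.ofReal (Real.exp (-m)) * a := by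
  rcases eq_or_ne a ⊤ with rfl | ha
  · rw [ENNReal.mul_top (ENNReal.ofReal_pos.2 (Real.exp_pos _)).ne', add_top]; exact le_top
  have hreal : Real.exp (-m) * (1 + m) ≤ Real.exp (-a.toReal) + Real.exp (-m) * a.toReal := by
    have h := Real.add_one_le_exp (m - a.toReal)
    have hm := Real.exp_pos (-m)
    calc Real.exp (-m) * (1 + m)
        = Real.exp (-m) * (m - a.toReal + 1) + Real.exp (-m) * a.toReal := by ring
      _ ≤ Real.exp (-m) * Real.exp (m - a.toReal) + Real.exp (-m) * a.toReal := by gcongr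
      _ = Real.exp (-a.toReal) + Real.exp (-m) * a.toReal := by
          rw [← Real.exp_add, show -m + (m - a.toReal) = -a.toReal by ring]
  calc ENNReal.ofReal (Real.exp (-m) * (1 + m))
      ≤ ENNReal.ofReal (Real.exp (-a.toReal) + Real.exp (-m) * a.toReal) :=
        ENNReal.ofReal_le_ofReal hreal
    _ = expNeg a + ENNReal.ofReal (Real.exp (-m)) * a := by
        rw [ENNReal.ofReal_add (Real.exp_pos _).le (by positivity),
          ENNReal.ofReal_mul (Real.exp_pos _).le, ENNReal.ofReal_toReal ha, expNeg, if_neg ha]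

/-- **Integrating the tangent-line inequality** against a datum `ψ ≥ 0` and a kernel `T ≥ 0`:
`e^{-m}(1+m) ∫∫ ψ T ≤ ∫∫ ψ e^{-a} T + e^{-m} ∫∫ ψ a T`. [folklore] -/
theorem flatJensen_integrate {α β : Type*} [MeasurableSpace α] [MeasurableSpace β]
    (μ : Measure α) (ν : Measure β) [SFinite ν] {ψ : α → ℝ≥0∞} {a T : α → β → ℝ≥0∞}
    (hψ : Measurable ψ) (ha : Measurable (Function.uncurry a))
    (hT : Measurable (Function.uncurry T)) (m : ℝ) :
    ENNReal.ofReal (Real.exp (-m) * (1 + m)) * ∫⁻ x, ∫⁻ y, ψ x * T x y ∂ν ∂μ ≤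
      (∫⁻ x, ∫⁻ y, ψ x * (expNeg (a x y) * T x y) ∂ν ∂μ) +
        ENNReal.ofReal (Real.exp (-m)) * ∫⁻ x, ∫⁻ y, ψ x * (a x y * T x y) ∂ν ∂μ := by
  have hJ : Measurable fun p : α × β => ψ p.1 * (a p.1 p.2 * T p.1 p.2) :=
    (hψ.comp measurable_fst).mul (ha.mul hT)
  have hJx : ∀ x, Measurable fun y => ψ x * (a x y * T x y) := fun x =>
    hJ.comp measurable_prodMk_left
  have hJi : Measurable fun x => ∫⁻ y, ψ x * (a x y * T x y) ∂ν := hJ.lintegral_prod_right'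
  rw [← lintegral_const_mul' _ _ ENNReal.ofReal_ne_top, ← lintegral_const_mul _ hJi,
    ← lintegral_add_right _ (hJi.const_mul _)]
  refine lintegral_mono fun x => ?_
  rw [← lintegral_const_mul' _ _ ENNReal.ofReal_ne_top, ← lintegral_const_mul _ (hJx x),
    ← lintegral_add_right _ ((hJx x).const_mul _)]
  refine lintegral_mono fun y => ?_
  calc ENNReal.ofReal (Real.exp (-m) * (1 + m)) * (ψ x * T x y)
      ≤ (expNeg (a x y) + ENNReal.ofReal (Real.exp (-m)) * a x y) * (ψ x * T x y) :=
        mul_le_mul' (flatJensen_tangent _ m) le_rfl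
    _ = ψ x * (expNeg (a x y) * T x y) +
          ENNReal.ofReal (Real.exp (-m)) * (ψ x * (a x y * T x y)) := by ring

/-! ### Splitting the `(N+1)`-body action at the tag

The **coupling action** of a sample is `a(X, ω) = ∫₀ᵗ ∑ⱼ v^per(B⁰_s - Bʲ⁺¹_s) ds`; the **bath
factor** is `e^{-∫₀ᵗ V_N(tails)} Θ₀(tails of B_t)`, a function of the bath start `vecTail X` and of
the tail `ω ∘ succ` of the sample only. Both are written out in full below. -/

/-- **Action split**: the `(N+1)`-body periodised action is the coupling action of particle `0`
plus the bath action of the tail world-lines (`periodicInteraction_succ`). [folklore] -/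
theorem flatJensen_periodicPathAction_split {v : ℝ → ℝ≥0∞} (hv : Measurable v) (L t : ℝ)
    (X : Config (N + 1)) (ω : PathSpace (N + 1)) :
    periodicPathAction v L t X ω =
      (∫⁻ s in Set.Ioc (0 : ℝ) t, ∑ j : Fin N, periodizedPotential v L
        (worldLine X ω s.toNNReal 0 - worldLine X ω s.toNNReal j.succ)) +
      periodicPathAction v L t (vecTail X) (fun i => ω i.succ) := by
  have hm : Measurable fun s : ℝ =>
      periodicInteraction v L (worldLine (vecTail X) (fun i => ω i.succ) s.toNNReal) :=
    (measurable_periodicInteraction hv L).comp (continuous_worldLine_toNNReal _ _).measurable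
  unfold periodicPathAction
  rw [← lintegral_add_right _ hm]
  refine lintegral_congr fun s => ?_
  rw [periodicInteraction_succ]
  rfl

/-- The coupling action is jointly measurable in the start and the sample (Tonelli). [folklore] -/
theorem flatJensen_measurable_coupling {v : ℝ → ℝ≥0∞} (hv : Measurable v) (L t : ℝ) :
    Measurable fun p : Config (N + 1) × PathSpace (N + 1) =>
      ∫⁻ s in Set.Ioc (0 : ℝ) t, ∑ j : Fin N, periodizedPotential v L
        (worldLine p.1 p.2 s.toNNReal 0 - worldLine p.1 p.2 s.toNNReal j.succ) := by
  have hW : Measurable fun q : (Config (N + 1) × PathSpace (N + 1)) × ℝ =>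
      worldLine q.1.1 q.1.2 q.2.toNNReal := measurable_worldLine_prod
  have hs : Measurable fun q : (Config (N + 1) × PathSpace (N + 1)) × ℝ => ∑ j : Fin N,
      periodizedPotential v L
        (worldLine q.1.1 q.1.2 q.2.toNNReal 0 - worldLine q.1.1 q.1.2 q.2.toNNReal j.succ) :=
    Finset.measurable_sum _ fun j _ => (measurable_periodizedPotential hv L).comp
      (((measurable_pi_apply 0).comp hW).sub ((measurable_pi_apply j.succ).comp hW))
  exact hs.lintegral_prod_right'

/-- The bath factor is jointly measurable in the bath start and the sample. [folklore] -/
theorem flatJensen_measurable_bath {v : ℝ → ℝ≥0∞} (hv : Measurable v) (L t : ℝ)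
    {Θ₀ : Config N → ℝ} (hΘm : Measurable Θ₀) :
    Measurable fun p : Config N × PathSpace (N + 1) =>
      periodicFKWeight v L t p.1 (fun i => p.2 i.succ) *
        ENNReal.ofReal (Θ₀ (worldLine p.1 (fun i => p.2 i.succ) t.toNNReal)) := by
  have hT : Measurable fun p : Config N × PathSpace (N + 1) =>
      (p.1, fun i : Fin N => p.2 i.succ) :=
    measurable_fst.prodMk
      (measurable_pi_lambda _ fun i => (measurable_pi_apply _).comp measurable_snd)
  exact ((measurable_periodicFKWeight_uncurry hv L t).comp hT).mul
    ((ENNReal.measurable_ofReal.comp hΘm).comp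
      ((measurable_worldLine_uncurry' t.toNNReal).comp hT))

/-! ### The three pairings -/

/-- `Z t` along the action split: the weight is `e^{-a}` times the bath weight of the tails
(`expNeg_add`), so `Z t = ∫_cell ∫ ψ₀ · e^{-a} · (bath factor)`. [folklore] -/
theorem flatJensen_Z_eq {v : ℝ → ℝ≥0∞} (hv : Measurable v) (L t : ℝ) (Θ₀ : Config N → ℝ) :
    ∫⁻ X in cellN (N + 1) L, ENNReal.ofReal (Θ₀ (vecTail X)) *
        periodicFKSemigroup v L t (fun Y => ENNReal.ofReal (Θ₀ (vecTail Y))) X =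
      ∫⁻ X in cellN (N + 1) L, ∫⁻ ω, ENNReal.ofReal (Θ₀ (vecTail X)) *
        (expNeg (∫⁻ s in Set.Ioc (0 : ℝ) t, ∑ j : Fin N, periodizedPotential v L
            (worldLine X ω s.toNNReal 0 - worldLine X ω s.toNNReal j.succ)) *
          (periodicFKWeight v L t (vecTail X) (fun i => ω i.succ) *
            ENNReal.ofReal (Θ₀ (worldLine (vecTail X) (fun i => ω i.succ) t.toNNReal))))
        ∂wienerPaths (N + 1) := by
  refine lintegral_congr fun X => ?_
  rw [periodicFKSemigroup, ← lintegral_const_mul' _ _ ENNReal.ofReal_ne_top]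
  refine lintegral_congr fun ω => ?_
  unfold periodicFKWeight
  rw [flatJensen_periodicPathAction_split hv, expNeg_add, mul_assoc]
  rfl

/-- **Marginalising the first world-line in the bath factor**:
`∫ (bath factor)(Y, ω) dW_{N+1}(ω) = (e^{-tH_N}Θ₀)(Y) = e^{-tE₀} Θ₀(Y)`. [folklore] -/
theorem flatJensen_lintegral_bath {v : ℝ → ℝ≥0∞} (hv : Measurable v) {L : ℝ}
    {Θ₀ : Config N → ℝ} (hΘ : IsPeriodicGroundStateFK v L Θ₀) {t : ℝ} (ht : 0 ≤ t)
    (Y : Config N) :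
    ∫⁻ ω, periodicFKWeight v L t Y (fun i => ω i.succ) *
        ENNReal.ofReal (Θ₀ (worldLine Y (fun i => ω i.succ) t.toNNReal)) ∂wienerPaths (N + 1) =
      ENNReal.ofReal (Real.exp (-((periodicGroundStateEnergy v N L).toReal * t))) *
        ENNReal.ofReal (Θ₀ Y) := by
  have hθm : Measurable fun Y : Config N => ENNReal.ofReal (Θ₀ Y) :=
    ENNReal.measurable_ofReal.comp hΘ.measurable
  have h := flatDom_lintegral_tail (N := N) (F := fun ω' =>
      periodicFKWeight v L t Y ω' * ENNReal.ofReal (Θ₀ (worldLine Y ω' t.toNNReal)))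
    ((measurable_periodicFKWeight hv L t Y).mul (hθm.comp (measurable_worldLine Y _)))
  refine h.trans ?_
  rw [← ENNReal.ofReal_mul (Real.exp_pos _).le, ← hΘ.eigen t ht Y]
  rfl

/-- **The decoupled pairing**: `∫_cell ∫ ψ₀ · (bath factor) = e^{-tE₀} L³`. [folklore] -/
theorem flatJensen_decoupled_eq {v : ℝ → ℝ≥0∞} (hv : Measurable v) {L : ℝ} (hL : 0 < L)
    {Θ₀ : Config N → ℝ} (hΘ : IsPeriodicGroundStateFK v L Θ₀) {t : ℝ} (ht : 0 ≤ t) :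
    ∫⁻ X in cellN (N + 1) L, ∫⁻ ω, ENNReal.ofReal (Θ₀ (vecTail X)) *
        (periodicFKWeight v L t (vecTail X) (fun i => ω i.succ) *
          ENNReal.ofReal (Θ₀ (worldLine (vecTail X) (fun i => ω i.succ) t.toNNReal)))
        ∂wienerPaths (N + 1) =
      ENNReal.ofReal (Real.exp (-((periodicGroundStateEnergy v N L).toReal * t))) *
        ENNReal.ofReal (L ^ 3) := by
  rw [← flatDom_setLIntegral_tail_mul hL hΘ]
  refine lintegral_congr fun X => ?_
  rw [lintegral_const_mul' _ _ ENNReal.ofReal_ne_top, flatJensen_lintegral_bath hv hΘ ht]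

/-- **Stationarity of the uniform start of particle `0`**: for every bath start `Y` and sample
`ω`, `∫_{cell} a((x, Y), ω) dx = t · N · ∫_{ℝ³} v(|z|) dz`: the relative position of particles
`0` and `j+1` is `x - c` with a shift `c = c(Y, ω, s, j)` not depending on `x`, Tonelli, and
`∫_cell v^per(x - c) dx = ∫_{ℝ³} v` (`lintegral_cell_periodizedPotential_sub`). [folklore] -/
theorem flatJensen_setLIntegral_cell_coupling {v : ℝ → ℝ≥0∞} (hv : Measurable v) {L : ℝ}
    (hL : 0 < L) (t : ℝ) (Y : Config N) (ω : PathSpace (N + 1)) :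
    ∫⁻ x in cell L, ∫⁻ s in Set.Ioc (0 : ℝ) t, ∑ j : Fin N, periodizedPotential v L
        (worldLine (vecCons x Y) ω s.toNNReal 0 - worldLine (vecCons x Y) ω s.toNNReal j.succ) =
      ENNReal.ofReal t * N * ∫⁻ z : Space, v ‖z‖ := by
  have hpV := measurable_periodizedPotential hv L
  have hW := continuous_worldLine_toNNReal (0 : Config (N + 1)) ω
  set c : ℝ → Fin N → Space := fun s j =>
    Y j + worldLine 0 ω s.toNNReal j.succ - worldLine 0 ω s.toNNReal 0 with hc
  have hcm : ∀ j, Measurable fun s => c s j := fun j =>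
    (measurable_const.add ((continuous_apply j.succ).comp hW).measurable).sub
      ((continuous_apply 0).comp hW).measurable
  have hcx : ∀ x s j, worldLine (vecCons x Y) ω s.toNNReal 0 -
      worldLine (vecCons x Y) ω s.toNNReal j.succ = x - c s j := fun x s j => by
    rw [← zero_add (vecCons x Y), worldLine_add_right]
    simp only [hc, Pi.add_apply, Matrix.cons_val_zero, Matrix.cons_val_succ]
    abel
  simp only [hcx]
  have hxs : Measurable fun p : Space × ℝ => ∑ j : Fin N,
      periodizedPotential v L (p.1 - c p.2 j) :=
    Finset.measurable_sum _ fun j _ => hpV.comp (measurable_fst.sub ((hcm j).comp measurable_snd))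
  rw [lintegral_lintegral_swap hxs.aemeasurable]
  have hin : ∀ s : ℝ, ∫⁻ x in cell L, ∑ j : Fin N, periodizedPotential v L (x - c s j) =
      N * ∫⁻ z : Space, v ‖z‖ := fun s => by
    have hmj : ∀ j : Fin N, Measurable fun x : Space => periodizedPotential v L (x - c s j) :=
      fun j => hpV.comp (measurable_id.sub_const _)
    rw [lintegral_finsetSum _ fun j _ => hmj j]
    simp only [lintegral_cell_periodizedPotential_sub hL hv, Finset.sum_const, Finset.card_univ,
      Fintype.card_fin, nsmul_eq_mul]
  simp only [hin]
  rw [setLIntegral_const, Real.volume_Ioc, sub_zero]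
  ring

/-- **The coupled pairing**: `∫_cell ∫ ψ₀ · a · (bath factor) = t N κ e^{-tE₀}` (Tonelli with
the start of particle `0` innermost, stationarity, marginalisation of the first world-line, the
eigen-relation and `∫_cell Θ₀² = 1`). [folklore] -/
theorem flatJensen_coupled_eq {v : ℝ → ℝ≥0∞} (hv : Measurable v) {L : ℝ} (hL : 0 < L)
    {Θ₀ : Config N → ℝ} (hΘ : IsPeriodicGroundStateFK v L Θ₀) {t : ℝ} (ht : 0 ≤ t) :
    ∫⁻ X in cellN (N + 1) L, ∫⁻ ω, ENNReal.ofReal (Θ₀ (vecTail X)) *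
        ((∫⁻ s in Set.Ioc (0 : ℝ) t, ∑ j : Fin N, periodizedPotential v L
            (worldLine X ω s.toNNReal 0 - worldLine X ω s.toNNReal j.succ)) *
          (periodicFKWeight v L t (vecTail X) (fun i => ω i.succ) *
            ENNReal.ofReal (Θ₀ (worldLine (vecTail X) (fun i => ω i.succ) t.toNNReal))))
        ∂wienerPaths (N + 1) =
      ENNReal.ofReal t * N * (∫⁻ z : Space, v ‖z‖) *
        ENNReal.ofReal (Real.exp (-((periodicGroundStateEnergy v N L).toReal * t))) := by
  have hθm : Measurable fun Y : Config N => ENNReal.ofReal (Θ₀ Y) :=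
    ENNReal.measurable_ofReal.comp hΘ.measurable
  have hcA := flatJensen_measurable_coupling (N := N) hv L t
  have hT := flatJensen_measurable_bath hv L t hΘ.measurable
  have hT1 := hT.comp ((measurable_vecTail.comp measurable_fst).prodMk measurable_snd)
  have hF : Measurable fun X : Config (N + 1) => ∫⁻ ω, ENNReal.ofReal (Θ₀ (vecTail X)) *
      ((∫⁻ s in Set.Ioc (0 : ℝ) t, ∑ j : Fin N, periodizedPotential v L
          (worldLine X ω s.toNNReal 0 - worldLine X ω s.toNNReal j.succ)) *
        (periodicFKWeight v L t (vecTail X) (fun i => ω i.succ) *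
          ENNReal.ofReal (Θ₀ (worldLine (vecTail X) (fun i => ω i.succ) t.toNNReal))))
      ∂wienerPaths (N + 1) :=
    ((hθm.comp (measurable_vecTail.comp measurable_fst)).mul (hcA.mul hT1)).lintegral_prod_right'
  rw [setLIntegral_cellN_succ_right hF]
  simp only [Matrix.tail_cons]
  have hY : ∀ Y : Config N, ∫⁻ x in cell L, ∫⁻ ω, ENNReal.ofReal (Θ₀ Y) *
      ((∫⁻ s in Set.Ioc (0 : ℝ) t, ∑ j : Fin N, periodizedPotential v L
          (worldLine (vecCons x Y) ω s.toNNReal 0 - worldLine (vecCons x Y) ω s.toNNReal j.succ)) *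
        (periodicFKWeight v L t Y (fun i => ω i.succ) *
          ENNReal.ofReal (Θ₀ (worldLine Y (fun i => ω i.succ) t.toNNReal)))) ∂wienerPaths (N + 1) =
      ENNReal.ofReal t * N * (∫⁻ z : Space, v ‖z‖) *
        ENNReal.ofReal (Real.exp (-((periodicGroundStateEnergy v N L).toReal * t))) *
        ENNReal.ofReal (Θ₀ Y) ^ 2 := by
    intro Y
    have h2 : Measurable fun p : Space × PathSpace (N + 1) => (Y, p.2) :=
      measurable_const.prodMk measurable_snd
    have hc1 := hcA.comp ((measurable_vecCons.comp
      (measurable_fst.prodMk (measurable_const (a := Y)))).prodMk measurable_snd)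
    have hT2 := hT.comp h2
    have hTω := hT.comp (measurable_prodMk_left (x := Y))
    simp only [Function.comp_def] at hTω
    rw [lintegral_lintegral_swap ((hc1.mul hT2).const_mul _).aemeasurable]
    conv_lhs => enter [2, ω]; rw [lintegral_const_mul' _ _ ENNReal.ofReal_ne_top,
      lintegral_mul_const' _ _
        (ENNReal.mul_ne_top (periodicFKWeight_ne_top _ _ _ _ _) ENNReal.ofReal_ne_top),
      flatJensen_setLIntegral_cell_coupling hv hL t Y ω]
    rw [lintegral_const_mul' _ _ ENNReal.ofReal_ne_top, lintegral_const_mul _ hTω,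
      flatJensen_lintegral_bath hv hΘ ht Y]
    ring
  simp only [hY]
  rw [lintegral_const_mul _ (hθm.pow_const 2), hΘ.norm_eq, mul_one]

/-- **Core inequality** (tangent line at an arbitrary `m`, integrated):
`e^{-m}(1+m) · e^{-tE₀} L³ ≤ Z t + e^{-m} · t N κ e^{-tE₀}`. [folklore] -/
theorem flatJensen_core {v : ℝ → ℝ≥0∞} (hv : Measurable v) {L : ℝ} (hL : 0 < L)
    {Θ₀ : Config N → ℝ} (hΘ : IsPeriodicGroundStateFK v L Θ₀) {t : ℝ} (ht : 0 ≤ t) (m : ℝ) :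
    ENNReal.ofReal (Real.exp (-m) * (1 + m)) *
        (ENNReal.ofReal (Real.exp (-((periodicGroundStateEnergy v N L).toReal * t))) *
          ENNReal.ofReal (L ^ 3)) ≤
      (∫⁻ X in cellN (N + 1) L, ENNReal.ofReal (Θ₀ (vecTail X)) *
          periodicFKSemigroup v L t (fun Y => ENNReal.ofReal (Θ₀ (vecTail Y))) X) +
        ENNReal.ofReal (Real.exp (-m)) * (ENNReal.ofReal t * N * (∫⁻ z : Space, v ‖z‖) *
          ENNReal.ofReal (Real.exp (-((periodicGroundStateEnergy v N L).toReal * t)))) := by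
  rw [flatJensen_Z_eq hv, ← flatJensen_decoupled_eq hv hL hΘ ht,
    ← flatJensen_coupled_eq hv hL hΘ ht]
  have hT := (flatJensen_measurable_bath hv L t hΘ.measurable).comp
    ((measurable_vecTail.comp measurable_fst).prodMk measurable_snd)
  refine flatJensen_integrate _ _
    ((ENNReal.measurable_ofReal.comp hΘ.measurable).comp measurable_vecTail) ?_ ?_ m
  · exact flatJensen_measurable_coupling hv L t
  · exact hT

/-- **Stub 3 of line `residue-area-law` — flat Jensen: `𝒵(t) ≥ L³ e^{-t(E₀(N) + κ N/L³)}`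
with `κ = ∫_{ℝ³} v(|z|) dz`, for a bounded repulsive finite-range `v`, fixed `N`, `L > 0`,
`t ≥ 0`.** With `ψ₀ = Θ₀ ∘ vecTail` and `Z t = ∫_{cellN (N+1) L} ψ₀ · e^{-tH_{N+1}}ψ₀`: along
every sample the `(N+1)`-body action is the coupling action `a` of particle `0` plus the bath
action of the tails; the tangent line `e^{-m}(1+m) ≤ e^{-a} + e^{-m}a` of the convex `e^{-x}`,
integrated against the bath weight and `ψ₀(B_0)ψ₀(B_t)`, gives
`e^{-m}(1+m) e^{-tE₀}L³ ≤ Z t + e^{-m} tNκ e^{-tE₀}` (marginalise the first world-line and use the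
eigen-relation; the coupled pairing is computed by the stationarity of the uniform start of
particle `0`, `∫_cell v^per(x₀ - c) dx₀ = κ`), and `m = tNκ/L³` cancels the finite coupled term:
first-order perturbation theory bounds the decay rate of the flat state.
[cite: ReedSimonI1980, Thm VIII.5; KipnisLandim1999, App. 1 §6 (6.1)] -/
theorem stub_flatJensen (v : ℝ → ℝ≥0∞) (hv : IsRepulsiveFiniteRange v)
    (hbdd : ∃ C : ℝ≥0, ∀ r, v r ≤ C) :
    ∃ κ : ℝ, 0 ≤ κ ∧ ∀ (N : ℕ) (L : ℝ), 0 < L →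
      (∃ C : ℝ≥0, ∀ x, periodizedPotential v L x ≤ C) →
      ∀ (Θ₀ : Config N → ℝ), IsPeriodicGroundStateFK v L Θ₀ → Continuous Θ₀ →
      ∀ (Z : ℝ → ℝ≥0∞),
        (Z = fun t => ∫⁻ X in cellN (N + 1) L, ENNReal.ofReal (Θ₀ (vecTail X)) *
          periodicFKSemigroup v L t (fun Y => ENNReal.ofReal (Θ₀ (vecTail Y))) X) →
      ∀ t : ℝ, 0 ≤ t →
        ENNReal.ofReal (L ^ 3 * Real.exp
          (-(((periodicGroundStateEnergy v N L).toReal + κ * N / L ^ 3) * t))) ≤ Z t := by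
  obtain ⟨κn, hκn⟩ : ∃ κn : ℝ≥0, (κn : ℝ≥0∞) = ∫⁻ z : Space, v ‖z‖ :=
    ⟨_, ENNReal.coe_toNNReal (flatJensen_lintegral_potential_ne_top hv hbdd)⟩
  refine ⟨κn, κn.coe_nonneg, ?_⟩
  intro N L hL _hC Θ₀ hΘ _hΘc Z hZ t ht
  subst hZ
  have key := flatJensen_core hv.1 hL hΘ ht ((κn : ℝ) * N / L ^ 3 * t)
  rw [← hκn] at key
  set E : ℝ := (periodicGroundStateEnergy v N L).toReal with hE
  set m : ℝ := (κn : ℝ) * N / L ^ 3 * t with hm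
  have hm0 : 0 ≤ m := by rw [hm]; positivity
  have hL0 : L ≠ 0 := hL.ne'
  have hB : ENNReal.ofReal (Real.exp (-m)) *
      (ENNReal.ofReal t * N * (κn : ℝ≥0∞) * ENNReal.ofReal (Real.exp (-(E * t)))) =
      ENNReal.ofReal (Real.exp (-m) * (t * N * κn * Real.exp (-(E * t)))) := by
    rw [← ENNReal.ofReal_coe_nnreal, ← ENNReal.ofReal_natCast, ← ENNReal.ofReal_mul ht,
      ← ENNReal.ofReal_mul (by positivity), ← ENNReal.ofReal_mul (by positivity),
      ← ENNReal.ofReal_mul (Real.exp_pos _).le]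
  have hA : ENNReal.ofReal (Real.exp (-m) * (1 + m)) *
      (ENNReal.ofReal (Real.exp (-(E * t))) * ENNReal.ofReal (L ^ 3)) =
      ENNReal.ofReal (L ^ 3 * Real.exp (-((E + κn * N / L ^ 3) * t))) +
        ENNReal.ofReal (Real.exp (-m) * (t * N * κn * Real.exp (-(E * t)))) := by
    rw [← ENNReal.ofReal_mul (Real.exp_pos _).le, ← ENNReal.ofReal_mul (by positivity),
      ← ENNReal.ofReal_add (by positivity) (by positivity)]
    congr 1
    rw [hm, show -((E + κn * N / L ^ 3) * t) = -(E * t) + -(κn * N / L ^ 3 * t) by ring,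
      Real.exp_add]
    field_simp
  rw [hB, hA] at key
  exact (ENNReal.add_le_add_iff_right ENNReal.ofReal_ne_top).1 key

end Summit.AtomisticToContinuum.BoseEinsteinCondensation.Theorems.CorrectorClosure.ResidueAreaLaw
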